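import Summits.BirchSwinnertonDyer.Rank1Residual.AdditivePotMult.QuadraticBaseChangeOddTamagawaPlaces
import Literature.NumberTheory.EllipticCurves.QuadraticTwistIntegralModel
import HarnessLib

/-!
# The unit terms (`δ`-terms) of the odd Tamagawa identity, and the unit twist at a good place of
# any residue characteristic (row T-MIL-ODD, FILE C-3c; seat n1011-p01 GEN 6)

HONEST FRAMING (cell `b2b-bsdres`, run/shared/lean/b2b/bsd-rank1-residual/, verbatim in every
file): the goal of the cell is to DELETE the COMBINATION-SHAPED residual classes of the
Birch–Swinnerton-Dyer formula for ALL analytic-rank `≤ 1` elliptic curves over `ℚ` — "full BSD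
formula for every rank `≤ 1` curve in class `C`" assembled STRICTLY from published theorems — so
that the rank-`≤ 1` remainder becomes exactly the CONSTRUCTION-SHAPED classes, which are TYPED
(missing-input `Prop`s), NOT attempted. This is not "finishing BSD". Sub-classes X3♯(M) / X4(M)
(additive, potentially multiplicative prime; base-change-and-descend): a RESEARCH ROUTE; they stay
CONSTRUCTION-SHAPED; nothing is booked by this file; no mark / label moved. THEOREMS ONLY: no
definition, no named fact, no `sorry`.

## What and why (row T-MIL-ODD, `cells/n1011/skel/T-MIL-ODD.md` §1 (D) and §6)

Hypothesis (P) of the assembly schema (FILE C-2) at the odd prime `p` itself carries, besides the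
Tamagawa numbers, the UNIT TERMS of Milne's identity: `Σ_{w ∣ p} f(w|p)·ord_w(C'.u)` for the
globally minimal `K`-model `W' = C' • W_K`, and `ord_p(C_d.u)` for the globally minimal twist
`W_d = C_d • W^{(d)}` — in print the `δ`-invariants `δ_w = (e·ord Δ(W) − ord_w Δ_min(W_K))/12`,
`δ_{d,p} = (ord_p Δ(W^{(d)}) − ord_p Δ_min(W_d))/12` of the minimal models (Silverman *AEC* VII.1,
VIII.8). This file computes them from the stage-A minimal-discriminant bookkeeping:

* §2 `K`-side (`valuation_u_eq_one_of_ordMinimalDiscriminant_eq`, from A-4K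
  `valuation_u_pow_twelve_of_isMinimalAt`): `|C'.u|_w = 1` whenever
  `ord_w Δ_min(W_K) = e(w|v)·ord_v Δ_min(W)` — so above every GOOD place (`…_of_good`) and every
  MULTIPLICATIVE place (`…_of_mult`, A-1b); and `ord_w(C'.u) = 1` above the potentially
  multiplicative RAMIFIED place (`log_valuation_u_eq_neg_one_of_potMult`, A-4K);
* §3 `ℚ`-side: the master identity `12·log|C_d.u|_v = ord_v Δ_min(W_d) − ord_v Δ_min(W) + 6·log|d|_v`
  (`twelve_mul_log_valuation_u_eq`; `Δ(W_d) = u⁻¹² d⁶ Δ(W)`), whence `|C_d.u|_v = 1` at an odd place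
  which is good or multiplicative for `W`, whether `ℓ ∤ d` (A-3, A-2a: `ord Δ_min` unchanged) or
  `ℓ ∥ d` (A-3, A-2b: `ord Δ_min` jumps by `6`, `log|d|_v = −1`), and `ord_v(C_d.u) = 1` at the
  potentially multiplicative ramified place (A-4M `valuation_u_eq_exp_neg_one_of_mult_twist`);
* §1 the UNIT TWIST AT A GOOD PLACE OF ANY RESIDUE CHARACTERISTIC (`ℓ = 2` included):
  for `d ≡ 1 (mod 4)`, `ℓ ∤ d`, the integral twist model `twistModel k` (`d = 4k + 1`, tree
  `QuadraticTwistIntegralModel`; `Δ ↦ d⁶Δ`) of the `ℤ`-model of `W` is `v`-integral with unit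
  discriminant, hence `W^{(d)}` has good reduction at `v` and `c_v(W_d) = 1`
  (`hasGoodReductionAt_quadraticTwist_of_emod_four`, `localTamagawaNumber_twist_eq_one_of_good_of_emod_four`)
  — the `ℓ = 2` INERT good places of the END theorem (FILE C-3d), which stage A (odd places only) did
  not cover.

HONEST LIMITS: TOOL theorems; the multiplicative place `ℓ = 2` inert in `K` (the splitness flip of
the node under `twistModel`, skeleton (M4) at `2`) is NOT here; closes no class; discharges no fact
by itself.
-/

noncomputable section

open scoped Classical NumberField

open WeierstrassCurve NumberField IsDedekindDomain Rat.HeightOneSpectrum WithZero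
  Literature.NumberTheory.EllipticCurves
  Summit.BirchSwinnertonDyer.Rank1Residual.Additive

namespace Summit.BirchSwinnertonDyer.Rank1Residual.AdditivePotMult

/-! ## §1 The unit twist `d ≡ 1 (mod 4)` at a GOOD place of any residue characteristic -/

section GoodUnitTwist

variable (W : WeierstrassCurve ℚ) [W.IsElliptic] [W.IsGloballyMinimal] (v : HeightOneSpectrum (𝓞 ℚ))

omit [W.IsElliptic] in
/-- **Good reduction persists under a unit twist `d ≡ 1 (mod 4)`, at ANY residue characteristic**
(`ℓ = 2` included): for `W/ℚ` globally minimal and good at `v`, `ℓ_v ∤ d`, the twist `W^{(d)}` has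
good reduction at `v` — the integral twist model `(ℤ-model of W).twistModel k`, `d = 4k + 1` (tree
`QuadraticTwistIntegralModel`, `exists_variableChange_twistModel_eq_quadraticTwist`) is `v`-integral
with `|Δ|_v = |d|_v⁶ |Δ(W)|_v = 1` (tree `hasGoodReductionAt_of_valuation_Δ_eq_one_holds`,
`hasGoodReductionAt_smul_iff_holds`). Comalada 1994 §2 / Connell §4.3 (unramified quadratic twists
preserve the reduction type). [cite: SilvermanAEC2009, VII.1 Remark 1.1 and VII.5 Prop. 5.1(a)] -/
theorem hasGoodReductionAt_quadraticTwist_of_emod_four {d : ℤ} (hd4 : d % 4 = 1)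
    (hd : ¬ ((primesEquiv v : ℕ) : ℤ) ∣ d) (hgood : W.HasGoodReductionAt v) :
    (W.quadraticTwist (d : ℚ)).HasGoodReductionAt v := by
  -- `d = 4 k + 1`
  obtain ⟨k, hk⟩ : ∃ k : ℤ, d = 4 * k + 1 := ⟨d / 4, by omega⟩
  -- the integral twist model of the `ℤ`-model of `W`
  set M : WeierstrassCurve ℤ := integralModelInt W with hM
  have hWM : M.map (Int.castRingHom ℚ) = W := map_integralModelInt W
  set T : WeierstrassCurve ℤ := M.twistModel k with hT
  have hTQ : T.baseChange ℚ = W.twistModel (k : ℚ) := by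
    rw [baseChange, algebraMap_int_eq, hT, map_twistModel, hWM, eq_intCast]
  have hint : (W.twistModel (k : ℚ)).IsIntegralAt v := by
    rw [← hTQ]; exact isIntegralAt_baseChange_intModel T v
  -- `|Δ|_v = |d|^6 |Δ(W)| = 1`
  have hΔW : v.valuation ℚ W.Δ = 1 :=
    (hasGoodReductionAt_iff_of_isMinimalAt (IsGloballyMinimal.isMinimal (W := W) v)).mp hgood
  have hdv : v.valuation ℚ (d : ℚ) = 1 := valuation_ringOfIntegers_intCast_eq_one v hd
  have hd' : (4 * (k : ℚ) + 1) = (d : ℚ) := by rw [hk]; push_cast; ring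
  have hΔ : v.valuation ℚ (W.twistModel (k : ℚ)).Δ = 1 := by
    rw [twistModel_Δ, map_mul, map_pow, hd', hdv, one_pow, one_mul, hΔW]
  have hgoodT : (W.twistModel (k : ℚ)).HasGoodReductionAt v :=
    hasGoodReductionAt_of_valuation_Δ_eq_one_holds v _ hint hΔ
  -- the twist equation is a model of the same curve
  obtain ⟨C, -, hC⟩ := exists_variableChange_twistModel_eq_quadraticTwist W (k : ℚ)
  rw [hd'] at hC
  rw [← hC]
  exact (hasGoodReductionAt_smul_iff_holds v (W.twistModel (k : ℚ)) C).mpr hgoodT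

/-- **`c_v(W_d) = 1`** for any model `W_d = C_d • W^{(d)}` of the unit twist (`d ≡ 1 (mod 4)`, `ℓ_v ∤ d`)
at a good place of `W`, any residue characteristic. [cite: SilvermanATAEC1994, Cor. IV.9.2(d)] -/
theorem localTamagawaNumber_twist_eq_one_of_good_of_emod_four {d : ℤ} (hd4 : d % 4 = 1)
    (hd : ¬ ((primesEquiv v : ℕ) : ℤ) ∣ d) (hgood : W.HasGoodReductionAt v) {Wd : WeierstrassCurve ℚ}
    {Cd : VariableChange ℚ} (hWd : Cd • W.quadraticTwist (d : ℚ) = Wd) :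
    (Wd.baseChange (v.adicCompletion ℚ)).localTamagawaNumber (v.adicCompletionIntegers ℚ) = 1 := by
  have hd0 : (d : ℚ) ≠ 0 := by
    have : d ≠ 0 := by rintro rfl; omega
    exact_mod_cast this
  haveI := W.isElliptic_quadraticTwist hd0
  rw [localTamagawaNumber_eq_of_variableChange_eq hWd v]
  exact localTamagawaNumber_eq_one_of_hasGoodReductionAt_holds (W := W.quadraticTwist (d : ℚ)) v
    (hasGoodReductionAt_quadraticTwist_of_emod_four W v hd4 hd hgood)

end GoodUnitTwist

/-! ## §2 The `K`-side unit `C'.u`: `ord_w(C'.u)` -/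

section KUnit

variable (W : WeierstrassCurve ℚ) [W.IsElliptic] [W.IsGloballyMinimal] {K : Type} [Field K]
  [NumberField K] {v : HeightOneSpectrum (𝓞 ℚ)} (w : HeightOneSpectrum (𝓞 K))
  {W' : WeierstrassCurve K} {C' : VariableChange K}

/-- **`|C'.u|_w = 1` when `ord_w Δ_min(W_K) = e(w|v)·ord_v Δ_min(W)`** (`W/ℚ` globally minimal,
`W' = C' • W_K` minimal at `w ∣ v`): A-4K's `|C'.u|_w¹² · |Δ_min(W_K)|_w = |Δ_min(W)|_v^e` leaves
`|C'.u|_w¹² = 1`. (`δ_w = 0`: the `ℤ`-minimal equation stays minimal at `w`.)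
[cite: SilvermanAEC2009, VII.1 Prop. 1.3(a)–(b)] -/
theorem valuation_u_eq_one_of_ordMinimalDiscriminant_eq (hw : w.under (𝓞 ℚ) = v)
    (hW' : C' • W.baseChange K = W') (hmin : W'.IsMinimalAt w)
    (hord : (W.baseChange K).ordMinimalDiscriminant w =
      w.asIdeal.ramificationIdx (𝓞 ℚ) * W.ordMinimalDiscriminant v) :
    w.valuation K (C'.u : K) = 1 := by
  have h𝔭 : w.asIdeal.under (𝓞 ℚ) = v.asIdeal := by rw [← hw]; rfl
  have h := valuation_u_pow_twelve_of_isMinimalAt W w h𝔭 hW' hmin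
  rw [ramificationIdx'_eq_of_under_eq hw, ← hord] at h
  have hu0 : w.valuation K (C'.u : K) ≠ 0 := (Valuation.ne_zero_iff _).mpr (Units.ne_zero _)
  obtain ⟨m, hm⟩ : ∃ m : ℤ, w.valuation K (C'.u : K) = exp m := ⟨log _, (exp_log hu0).symm⟩
  have hX : exp (-((W.baseChange K).ordMinimalDiscriminant w : ℤ)) ≠ 0 := exp_ne_zero
  rw [mul_eq_right₀ hX, hm, ← exp_nsmul, ← exp_zero, exp_inj] at h
  rw [hm, ← exp_zero, exp_inj]
  simpa using h

/-- **`|C'.u|_w = 1` above a GOOD place of `W`** (`ord Δ_min = 0` on both sides, tree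
`ordMinimalDiscriminant_eq_zero_iff_holds` with A-3 `hasGoodReductionAt_baseChange_of_good`).
[cite: SilvermanAEC2009, VII.1 Prop. 1.3(b) and VII.5 Prop. 5.1(a)] -/
theorem valuation_u_eq_one_of_good (hw : w.under (𝓞 ℚ) = v) (hW' : C' • W.baseChange K = W')
    (hmin : W'.IsMinimalAt w) (hgood : W.HasGoodReductionAt v) :
    w.valuation K (C'.u : K) = 1 := by
  haveI : (W.baseChange K).IsElliptic := by rw [baseChange]; infer_instance
  have h𝔭 : w.asIdeal.under (𝓞 ℚ) = v.asIdeal := by rw [← hw]; rfl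
  refine valuation_u_eq_one_of_ordMinimalDiscriminant_eq W w hw hW' hmin ?_
  rw [(ordMinimalDiscriminant_eq_zero_iff_holds v W).mpr hgood,
    (ordMinimalDiscriminant_eq_zero_iff_holds w (W.baseChange K)).mpr
      (hasGoodReductionAt_baseChange_of_good W w hgood h𝔭), mul_zero]

/-- **`|C'.u|_w = 1` above a MULTIPLICATIVE place of `W`** (`ord_w Δ_min(W_K) = e·n`, A-1b
`ordMinimalDiscriminant_baseChange_eq_mul_of_hasMultiplicativeReductionAt`).
[cite: SilvermanAEC2009, VII.1 Prop. 1.3(b) and VII.5 Prop. 5.1(b)] -/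
theorem valuation_u_eq_one_of_mult (hw : w.under (𝓞 ℚ) = v) (hW' : C' • W.baseChange K = W')
    (hmin : W'.IsMinimalAt w) (hmult : W.HasMultiplicativeReductionAt v) :
    w.valuation K (C'.u : K) = 1 := by
  have h𝔭 : w.asIdeal.under (𝓞 ℚ) = v.asIdeal := by rw [← hw]; rfl
  refine valuation_u_eq_one_of_ordMinimalDiscriminant_eq W w hw hW' hmin ?_
  rw [ordMinimalDiscriminant_baseChange_eq_mul_of_hasMultiplicativeReductionAt W w hmult h𝔭,
    ramificationIdx'_eq_of_under_eq hw]

/-- **`ord_w(C'.u) = 1` above the potentially multiplicative RAMIFIED place** (`W_d` multiplicative at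
`v`, `ℓ ∥ d` odd, `e(w|v) = 2`): A-4K
`valuation_u_eq_exp_neg_one_of_mult_twist_of_ramificationIdx_eq_two` (`ord_w Δ_min(W_K) = 2n`,
`ord_v Δ_min(W) = n + 6`), read through `log`. The `K`-side `δ`-term `δ_w = 1` of skeleton §1 (D).
[cite: SilvermanAEC2009, VII.1 Prop. 1.3(a) and Table 3.1] -/
theorem log_valuation_u_eq_neg_one_of_potMult (Wd : WeierstrassCurve ℚ) [Wd.IsElliptic]
    [Wd.IsGloballyMinimal] (hv2 : (primesEquiv v : ℕ) ≠ 2) {d : ℤ}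
    (hd1 : ((primesEquiv v : ℕ) : ℤ) ∣ d) (hd2 : ¬ ((primesEquiv v : ℕ) : ℤ) ^ 2 ∣ d)
    {Cd : VariableChange ℚ} (hWd : Cd • W.quadraticTwist (d : ℚ) = Wd)
    (hmult : Wd.HasMultiplicativeReductionAt v) {θ : K} (hθ0 : θ ≠ 0)
    (hθ : θ ^ 2 = algebraMap ℚ K (d : ℚ)) (hw : w.under (𝓞 ℚ) = v)
    (he : w.asIdeal.ramificationIdx (𝓞 ℚ) = 2) (hW' : C' • W.baseChange K = W')
    (hmin : W'.IsMinimalAt w) :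
    log (w.valuation K (C'.u : K)) = -1 := by
  have h𝔭 : w.asIdeal.under (𝓞 ℚ) = v.asIdeal := by rw [← hw]; rfl
  have he' : v.asIdeal.ramificationIdx' w.asIdeal = 2 := by
    rw [ramificationIdx'_eq_of_under_eq hw, he]
  rw [valuation_u_eq_exp_neg_one_of_mult_twist_of_ramificationIdx_eq_two W Wd w hv2 hd1 hd2 hWd
    hmult hθ0 hθ h𝔭 he' hW' hmin, log_exp]

end KUnit

/-! ## §3 The `ℚ`-side unit `Cd.u`: `ord_v(Cd.u)` -/

section QUnit

variable (W Wd : WeierstrassCurve ℚ) [W.IsElliptic] [W.IsGloballyMinimal] [Wd.IsElliptic]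
  [Wd.IsGloballyMinimal] (v : HeightOneSpectrum (𝓞 ℚ))

/-- **The master identity for the twist scaling unit**: for `W`, `W_d = C_d • W^{(d)}` both globally
minimal over `ℚ` and `d ≠ 0`,
`12·log|C_d.u|_v = ord_v Δ_min(W_d) − ord_v Δ_min(W) + 6·log|d|_v` at every place `v` — from
`Δ(W_d) = C_d.u⁻¹² · d⁶ · Δ(W)` (Mathlib `variableChange_Δ`, tree `quadraticTwist_Δ`) and
`|Δ|_v = exp(−ord_v Δ_min)` on minimal equations (tree `valuation_Δ_eq_of_isMinimalAt_holds`).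
(`−log|C_d.u|_v = δ_{d,v}` of skeleton §1.) [cite: SilvermanAEC2009, VII.1 Prop. 1.3(a) and X.5 Cor. 5.4] -/
theorem twelve_mul_log_valuation_u_eq {d : ℤ} (hd0 : d ≠ 0) {Cd : VariableChange ℚ}
    (hWd : Cd • W.quadraticTwist (d : ℚ) = Wd) :
    12 * log (v.valuation ℚ (Cd.u : ℚ)) =
      (Wd.ordMinimalDiscriminant v : ℤ) - W.ordMinimalDiscriminant v +
        6 * log (v.valuation ℚ (d : ℚ)) := by
  have hdq : (d : ℚ) ≠ 0 := by exact_mod_cast hd0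
  have hΔW := valuation_Δ_eq_of_isMinimalAt_holds v W (IsGloballyMinimal.isMinimal v)
  have hΔWd := valuation_Δ_eq_of_isMinimalAt_holds v Wd (IsGloballyMinimal.isMinimal v)
  have hΔ : Wd.Δ = (↑Cd.u⁻¹ : ℚ) ^ 12 * ((d : ℚ) ^ 6 * W.Δ) := by
    rw [← hWd, variableChange_Δ, quadraticTwist_Δ]
  have hu0 : v.valuation ℚ (Cd.u : ℚ) ≠ 0 := (Valuation.ne_zero_iff _).mpr (Units.ne_zero _)
  have hdv0 : v.valuation ℚ (d : ℚ) ≠ 0 := (Valuation.ne_zero_iff _).mpr hdq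
  obtain ⟨m, hm⟩ : ∃ m : ℤ, v.valuation ℚ (Cd.u : ℚ) = exp m := ⟨log _, (exp_log hu0).symm⟩
  obtain ⟨k, hk⟩ : ∃ k : ℤ, v.valuation ℚ (d : ℚ) = exp k := ⟨log _, (exp_log hdv0).symm⟩
  have h := congrArg (v.valuation ℚ) hΔ
  rw [hΔWd, map_mul, map_mul, map_pow, map_pow, Units.val_inv_eq_inv_val, map_inv₀, hm, hk, hΔW,
    ← exp_neg, ← exp_nsmul, ← exp_nsmul, ← exp_add, ← exp_add, exp_inj] at h
  rw [hm, hk, log_exp, log_exp]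
  simp only [nsmul_eq_mul, Nat.cast_ofNat] at h
  linarith

/-- `|C_d.u|_v = 1` at a GOOD odd place with `ℓ ∤ d` (both `ord Δ_min` vanish: A-3
`hasGoodReductionAt_quadraticTwist_of_not_dvd`; `|d|_v = 1`). [cite: SilvermanAEC2009, VII.1 Prop. 1.3(a)] -/
theorem valuation_u_twist_eq_one_of_not_dvd_of_good (hv2 : (primesEquiv v : ℕ) ≠ 2) {d : ℤ}
    (hd0 : d ≠ 0) (hd : ¬ ((primesEquiv v : ℕ) : ℤ) ∣ d) {Cd : VariableChange ℚ}
    (hWd : Cd • W.quadraticTwist (d : ℚ) = Wd) (hgood : W.HasGoodReductionAt v) :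
    v.valuation ℚ (Cd.u : ℚ) = 1 := by
  have hdq : (d : ℚ) ≠ 0 := by exact_mod_cast hd0
  haveI := W.isElliptic_quadraticTwist hdq
  have h := twelve_mul_log_valuation_u_eq W Wd v hd0 hWd
  have hgoodT := (hasGoodReductionAt_quadraticTwist_of_not_dvd W v hv2 hd hgood).2
  have hordWd : Wd.ordMinimalDiscriminant v = 0 := by
    rw [← hWd, ordMinimalDiscriminant_smul_holds v (W.quadraticTwist (d : ℚ)) Cd]
    exact (ordMinimalDiscriminant_eq_zero_iff_holds v (W.quadraticTwist (d : ℚ))).mpr hgoodT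
  have hordW : W.ordMinimalDiscriminant v = 0 := (ordMinimalDiscriminant_eq_zero_iff_holds v W).mpr hgood
  rw [hordWd, hordW, valuation_ringOfIntegers_intCast_eq_one v hd, log_one] at h
  have hu0 : v.valuation ℚ (Cd.u : ℚ) ≠ 0 := (Valuation.ne_zero_iff _).mpr (Units.ne_zero _)
  rw [← exp_log hu0, ← exp_zero, exp_inj]
  simpa using h

/-- `|C_d.u|_v = 1` at a MULTIPLICATIVE odd place with `ℓ ∤ d` (`ord Δ_min(W^{(d)}) = ord Δ_min(W)`,
A-2a `hasMultiplicativeReductionAt_and_split_iff_quadraticTwist_of_not_dvd`; `|d|_v = 1`).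
[cite: SilvermanAEC2009, VII.1 Prop. 1.3(a)] -/
theorem valuation_u_twist_eq_one_of_not_dvd_of_mult (hv2 : (primesEquiv v : ℕ) ≠ 2) {d : ℤ}
    (hd0 : d ≠ 0) (hd : ¬ ((primesEquiv v : ℕ) : ℤ) ∣ d) {Cd : VariableChange ℚ}
    (hWd : Cd • W.quadraticTwist (d : ℚ) = Wd) (hmult : W.HasMultiplicativeReductionAt v) :
    v.valuation ℚ (Cd.u : ℚ) = 1 := by
  have hdq : (d : ℚ) ≠ 0 := by exact_mod_cast hd0
  haveI := W.isElliptic_quadraticTwist hdq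
  have h := twelve_mul_log_valuation_u_eq W Wd v hd0 hWd
  obtain ⟨-, hordT, -⟩ :=
    hasMultiplicativeReductionAt_and_split_iff_quadraticTwist_of_not_dvd W v hv2 hd hmult
  have hordWd : Wd.ordMinimalDiscriminant v = W.ordMinimalDiscriminant v := by
    rw [← hWd, ordMinimalDiscriminant_smul_holds v (W.quadraticTwist (d : ℚ)) Cd, hordT]
  rw [hordWd, valuation_ringOfIntegers_intCast_eq_one v hd, log_one] at h
  have hu0 : v.valuation ℚ (Cd.u : ℚ) ≠ 0 := (Valuation.ne_zero_iff _).mpr (Units.ne_zero _)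
  rw [← exp_log hu0, ← exp_zero, exp_inj]
  simpa using h

/-- `|C_d.u|_v = 1` at a GOOD odd place with `ℓ ∥ d` (`ord Δ_min(W^{(d)}) = 6`, A-3
`hasAdditiveReductionAt_and_ordMinimalDiscriminant_quadraticTwist_of_dvd_of_good`; `log|d|_v = −1`:
`12·log|u| = 6 − 0 − 6 = 0`). [cite: SilvermanAEC2009, VII.1 Prop. 1.3(a)] -/
theorem valuation_u_twist_eq_one_of_dvd_of_good (hv2 : (primesEquiv v : ℕ) ≠ 2) {d : ℤ}
    (hd1 : ((primesEquiv v : ℕ) : ℤ) ∣ d) (hd2 : ¬ ((primesEquiv v : ℕ) : ℤ) ^ 2 ∣ d)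
    {Cd : VariableChange ℚ} (hWd : Cd • W.quadraticTwist (d : ℚ) = Wd)
    (hgood : W.HasGoodReductionAt v) :
    v.valuation ℚ (Cd.u : ℚ) = 1 := by
  have hd0 : d ≠ 0 := by rintro rfl; exact hd2 (dvd_zero _)
  have hdq : (d : ℚ) ≠ 0 := by exact_mod_cast hd0
  haveI := W.isElliptic_quadraticTwist hdq
  have h := twelve_mul_log_valuation_u_eq W Wd v hd0 hWd
  obtain ⟨-, -, hordT⟩ :=
    hasAdditiveReductionAt_and_ordMinimalDiscriminant_quadraticTwist_of_dvd_of_good W v hv2 hd1 hd2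
      hgood
  have hordWd : Wd.ordMinimalDiscriminant v = 6 := by
    rw [← hWd, ordMinimalDiscriminant_smul_holds v (W.quadraticTwist (d : ℚ)) Cd, hordT]
  have hordW : W.ordMinimalDiscriminant v = 0 := (ordMinimalDiscriminant_eq_zero_iff_holds v W).mpr hgood
  rw [hordWd, hordW, valuation_ringOfIntegers_intCast_eq_exp_neg_one v hd1 hd2, log_exp] at h
  have hu0 : v.valuation ℚ (Cd.u : ℚ) ≠ 0 := (Valuation.ne_zero_iff _).mpr (Units.ne_zero _)
  rw [← exp_log hu0, ← exp_zero, exp_inj]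
  push_cast at h
  linarith

/-- `|C_d.u|_v = 1` at a MULTIPLICATIVE odd place with `ℓ ∥ d` (`ord Δ_min(W^{(d)}) = n + 6`, A-2b
`hasAdditiveReductionAt_quadraticTwist_of_dvd_of_mult`; `12·log|u| = (n + 6) − n − 6 = 0`).
[cite: SilvermanAEC2009, VII.1 Prop. 1.3(a)] -/
theorem valuation_u_twist_eq_one_of_dvd_of_mult (hv2 : (primesEquiv v : ℕ) ≠ 2) {d : ℤ}
    (hd1 : ((primesEquiv v : ℕ) : ℤ) ∣ d) (hd2 : ¬ ((primesEquiv v : ℕ) : ℤ) ^ 2 ∣ d)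
    {Cd : VariableChange ℚ} (hWd : Cd • W.quadraticTwist (d : ℚ) = Wd)
    (hmult : W.HasMultiplicativeReductionAt v) :
    v.valuation ℚ (Cd.u : ℚ) = 1 := by
  have hd0 : d ≠ 0 := by rintro rfl; exact hd2 (dvd_zero _)
  have hdq : (d : ℚ) ≠ 0 := by exact_mod_cast hd0
  haveI := W.isElliptic_quadraticTwist hdq
  have h := twelve_mul_log_valuation_u_eq W Wd v hd0 hWd
  obtain ⟨-, -, hordT⟩ := hasAdditiveReductionAt_quadraticTwist_of_dvd_of_mult W v hv2 hd1 hd2 hmult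
  have hordWd : Wd.ordMinimalDiscriminant v = W.ordMinimalDiscriminant v + 6 := by
    rw [← hWd, ordMinimalDiscriminant_smul_holds v (W.quadraticTwist (d : ℚ)) Cd, hordT]
  rw [hordWd, valuation_ringOfIntegers_intCast_eq_exp_neg_one v hd1 hd2, log_exp] at h
  have hu0 : v.valuation ℚ (Cd.u : ℚ) ≠ 0 := (Valuation.ne_zero_iff _).mpr (Units.ne_zero _)
  rw [← exp_log hu0, ← exp_zero, exp_inj]
  push_cast at h
  linarith

omit [W.IsGloballyMinimal] in
/-- **`ord_v(C_d.u) = 1` at the potentially multiplicative ramified place** (`W_d` multiplicative,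
`ℓ ∥ d` odd): A-4M `valuation_u_eq_exp_neg_one_of_mult_twist`, read through `log` — the twist-side
`δ`-term `δ_{d,p} = 1` of skeleton §1 (D). [cite: SilvermanAEC2009, VII.1 Prop. 1.3(a) and Table 3.1] -/
theorem log_valuation_u_twist_eq_neg_one_of_potMult (hv2 : (primesEquiv v : ℕ) ≠ 2) {d : ℤ}
    (hd1 : ((primesEquiv v : ℕ) : ℤ) ∣ d) (hd2 : ¬ ((primesEquiv v : ℕ) : ℤ) ^ 2 ∣ d)
    {Cd : VariableChange ℚ} (hWd : Cd • W.quadraticTwist (d : ℚ) = Wd)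
    (hmult : Wd.HasMultiplicativeReductionAt v) [W.IsGloballyMinimal] :
    log (v.valuation ℚ (Cd.u : ℚ)) = -1 := by
  rw [valuation_u_eq_exp_neg_one_of_mult_twist W Wd v hv2 hd1 hd2 hWd hmult, log_exp]

end QUnit

end Summit.BirchSwinnertonDyer.Rank1Residual.AdditivePotMult

end
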